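import Summits.Ventures.Crystal3D.TopCut.TammesCertDefs
import HarnessLib

/-!
# Soundness of the `S²` certificate checker (`TammesCertComp`) — part 2: chunk composition and the bound `|C| ≤ 12`

Continuation of `TopCut/TammesCertDefs.lean` (cell `pub-crystal3d`, seat p2's `TammesCertDefs`, split for the
gate by seat typer-bulk): the k-chunk composition lemmas (`ChunkSem`, `chunkSem_of_ok`, `chunkSem_trans`,
`boxNonneg_of_chunkSem`, `FChunkSem`, …) that let every Gram / `F` expansion be validated in several small kernel
computations, the comparison of the checks `checkI3`/`checkII3`/`checkSide3` with the hypotheses of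
`BachocVallentin.card_le_of_certificate3_int` (`FII_of_check3`, `AF_of_check3`, `bquad_nonneg_of_check3`,
`card_le_of_cert3`), and the numerical bound (`bound_of_check3`, `card_le_12_of_cert3`: a valid certificate with
`checkBound3` gives `|C| ≤ 12` for every finite set of unit vectors of `ℝ³` with pairwise inner products `≤ p/q`).

## References
* C. Bachoc, F. Vallentin, *New upper bounds for kissing numbers from semidefinite programming*,
  J. Amer. Math. Soc. 21 (2008) 909–924, Theorem 4.2, §5. [`BachocVallentin2007`]
-/

noncomputable section

open scoped RealInnerProductSpace

namespace Summit.Ventures.Crystal3D.TopCut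

open Literature.Geometry.DiscreteGeometry Literature.Geometry.DiscreteGeometry.PolyCert Literature.Geometry.DiscreteGeometry.PolyCert.SPoly Literature.Geometry.DiscreteGeometry.BachocVallentin Literature.Analysis.SpecialFunctions


namespace PolyCert.SPoly

/-! ### k-chunk composition (any number of row chunks / block chunks, one small kernel computation each) -/

/-- Semantic row chunk: `Dnext = Dprev + (rows i0 … i0+cnt-1 of zᵀ(LLᵀ)z)` on the unit box. [folklore] -/
def ChunkSem (g : GramBlk) (i0 cnt : ℕ) (Dprev Dnext : SPoly) : Prop :=
  ∀ u v t : ℝ, |u| ≤ 1 → |v| ≤ 1 → |t| ≤ 1 →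
    eval Dnext u v t = eval Dprev u v t + ∑ i ∈ Finset.Ico i0 (i0 + cnt), rowVal g u v t i

/-- A kernel chunk check yields a semantic chunk. [folklore] -/
theorem chunkSem_of_ok (g : GramBlk) (i0 cnt : ℕ) (Dprev Dnext : SPoly)
    (h : chunkOK g i0 cnt Dprev Dnext = true) : ChunkSem g i0 cnt Dprev Dnext :=
  fun u v t hu hv ht => eval_of_chunkOK g i0 cnt Dprev Dnext h u v t hu hv ht

/-- `lenOK` from any chunk check. [folklore] -/
theorem lenOK_of_chunkOK (g : GramBlk) (i0 cnt : ℕ) (Dprev Dnext : SPoly)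
    (h : chunkOK g i0 cnt Dprev Dnext = true) : g.lenOK = true := by
  simp only [chunkOK, Bool.and_eq_true] at h; exact h.1.1

/-- Consecutive semantic chunks compose. [folklore] -/
theorem chunkSem_trans (g : GramBlk) (i0 c1 c2 : ℕ) (D0 D1 D2 : SPoly)
    (h1 : ChunkSem g i0 c1 D0 D1) (h2 : ChunkSem g (i0 + c1) c2 D1 D2) : ChunkSem g i0 (c1 + c2) D0 D2 := by
  intro u v t hu hv ht
  rw [h2 u v t hu hv ht, h1 u v t hu hv ht, add_assoc,
    Finset.sum_Ico_consecutive _ (Nat.le_add_right i0 c1) (by omega : i0 + c1 ≤ i0 + c1 + c2),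
    show i0 + c1 + c2 = i0 + (c1 + c2) by omega]

/-- A full semantic chunk (all rows, from `[]`) makes the expansion nonnegative on the box. [folklore] -/
theorem boxNonneg_of_chunkSem (g : GramBlk) (R : SPoly) (hlen : g.lenOK = true)
    (h : ChunkSem g 0 g.z.length [] R) : BoxNonneg R := by
  intro u v t hu hv ht
  have e := h u v t hu hv ht
  rw [eval_nil, zero_add, Nat.zero_add, ← Finset.range_eq_Ico, ← eval_quadL_eq_sum_rowVal g hlen] at e
  rw [e]; exact eval_quadL_nonneg g hlen u v t

/-- Semantic block chunk of the three-point part: `Dnext = Dprev + F_int(bs)` on the box. [folklore] -/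
def FChunkSem (Dprev : SPoly) (bs : List FBlk) (Dnext : SPoly) : Prop :=
  ∀ u v t : ℝ, |u| ≤ 1 → |v| ≤ 1 → |t| ≤ 1 → eval Dnext u v t = eval Dprev u v t + Fval3 bs u v t

/-- A kernel block-chunk check yields a semantic block chunk. [folklore] -/
theorem fChunkSem_of_ok (bs : List FBlk) (Dprev Dnext : SPoly) (h : FchunkOK3 bs Dprev Dnext = true) :
    FChunkSem Dprev bs Dnext :=
  fun u v t hu hv ht => eval_of_FchunkOK3 bs Dprev Dnext h u v t hu hv ht

/-- Consecutive semantic block chunks compose. [folklore] -/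
theorem fChunkSem_trans (D0 D1 D2 : SPoly) (bs1 bs2 : List FBlk) (h1 : FChunkSem D0 bs1 D1)
    (h2 : FChunkSem D1 bs2 D2) : FChunkSem D0 (bs1 ++ bs2) D2 := by
  intro u v t hu hv ht
  rw [h2 u v t hu hv ht, h1 u v t hu hv ht, Fval3_append, add_assoc]

/-- A full semantic block chunk (from `[]`) is a valid `F` expansion. [folklore] -/
theorem fexpValid3_of_fChunkSem (F : List FBlk) (FP : SPoly) (h : FChunkSem [] F FP) : FexpValid3 F FP := by
  intro u v t hu hv ht
  rw [h u v t hu hv ht, eval_nil, zero_add]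


/-- `boxNonneg_of_chunkSem` with the row count given as a numeral `N = |z|`. [folklore] -/
theorem boxNonneg_of_chunkSem' (g : GramBlk) (R : SPoly) (N : ℕ) (hN : N = g.z.length) (hlen : g.lenOK = true)
    (h : ChunkSem g 0 N [] R) : BoxNonneg R := by
  subst hN; exact boxNonneg_of_chunkSem g R hlen h

/-- `fexpValid3_of_fChunkSem` with the block list given as an iterated append `F' = F`. [folklore] -/
theorem fexpValid3_of_fChunkSem' (F F' : List FBlk) (FP : SPoly) (hF : F' = F) (h : FChunkSem [] F' FP) :
    FexpValid3 F FP := by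
  subst hF; exact fexpValid3_of_fChunkSem F' FP h

set_option maxHeartbeats 4000000 in
/-- Soundness of `(II')` on `S²`: `F(u,v,t) ≤ -b₂₂` on `D'`, where `F = F_int/(6·4^Sp)`, `b₂₂ = B22/2^S`,
`s = p/q`. [folklore] -/
theorem FII_of_check3 (c : Cert3) (P : CertPolys)
    (hP : PolysOK3 c P) (h : checkII3 c P = true) (hs : checkSide3 c = true)
    (u v t : ℝ)
    (hu : -1 ≤ u) (hu' : u ≤ (c.p : ℝ) / c.q) (hv : -1 ≤ v) (hv' : v ≤ (c.p : ℝ) / c.q) (ht : -1 ≤ t)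
    (ht' : t ≤ (c.p : ℝ) / c.q) (hp1 : (c.p : ℝ) / c.q ≤ 1)
    (hp : 0 ≤ 1 + 2 * u * v * t - u ^ 2 - v ^ 2 - t ^ 2) :
    Fval3 c.F u v t / (6 * 4 ^ c.Sp) ≤ -(c.B22 / 2 ^ c.S) := by
  simp only [checkSide3, Bool.and_eq_true, decide_eq_true_eq] at hs
  obtain ⟨⟨⟨⟨⟨⟨⟨⟨hq0, _⟩, _⟩, _⟩, _⟩, _⟩, _⟩, _⟩, _⟩ := hs
  have hqR : (0 : ℝ) < c.q := by exact_mod_cast hq0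
  have hu1 : |u| ≤ 1 := abs_le.2 ⟨hu, by linarith⟩
  have hv1 : |v| ≤ 1 := abs_le.2 ⟨hv, by linarith⟩
  have ht1 : |t| ≤ 1 := abs_le.2 ⟨ht, by linarith⟩
  have hres := abs_eval_le_of_residualBound _ _ h hu1 hv1 ht1
  rw [eval_mergeAll] at hres
  simp only [List.map_cons, List.map_nil, List.sum_cons, List.sum_nil, add_zero, eval_neg, eval_C,
    Int.cast_natCast] at hres
  -- the box multipliers are nonnegative: (p - q x)(1 + x) ≥ 0 for -1 ≤ x ≤ p/q
  have mulx : ∀ x : ℝ, -1 ≤ x → x ≤ (c.p : ℝ) / c.q → 0 ≤ ((c.p : ℝ) - c.q * x) * (1 + x) := by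
    intro x hx hx'
    have : (c.q : ℝ) * x ≤ c.p := by
      have := mul_le_mul_of_nonneg_left hx' hqR.le
      rwa [mul_div_cancel₀ _ hqR.ne'] at this
    exact mul_nonneg (by linarith) (by linarith)
  have hrhs : 0 ≤ eval (rhsII3 c P) u v t := by
    have h0 := hP.hr u v t hu1 hv1 ht1
    have h1 := hP.hu u v t hu1 hv1 ht1
    have h2 := hP.hv u v t hu1 hv1 ht1
    have h3 := hP.ht u v t hu1 hv1 ht1
    have h4 := hP.h4 u v t hu1 hv1 ht1
    rw [rhsII3, eval_mergeAll]
    simp only [List.map_cons, List.map_nil, List.sum_cons, List.sum_nil, add_zero, eval_mulN, eval_smul,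
      eval_ptX3, eval_U, eval_V, eval_T, eval_p4]
    push_cast
    generalize eval P.Rr u v t = q0 at *
    generalize eval P.Ru u v t = q1' at *
    generalize eval P.Rv u v t = q2 at *
    generalize eval P.Rt u v t = q3 at *
    generalize eval P.R4 u v t = q4 at *
    have m1 := mulx u hu hu'
    have m2 := mulx v hv hv'
    have m3 := mulx t ht ht'
    have c1 : (0 : ℝ) ≤ 6 * c.q * 2 ^ c.S * 4 ^ c.Sp := by positivity
    have c2 : (0 : ℝ) ≤ 6 * 2 ^ c.S * 4 ^ c.Sp := by positivity
    have t0 := mul_nonneg c1 h0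
    have t1 := mul_nonneg c2 (mul_nonneg m1 h1)
    have t2 := mul_nonneg c2 (mul_nonneg m2 h2)
    have t3 := mul_nonneg c2 (mul_nonneg m3 h3)
    have t4 := mul_nonneg c1 (mul_nonneg hp h4)
    nlinarith [t0, t1, t2, t3, t4]
  generalize hR : eval (rhsII3 c P) u v t = R at hres hrhs
  generalize hT : eval (targetII3 c P) u v t = T at hres
  have hT0 : 0 ≤ T := by
    have h1 := (abs_le.1 hres).1
    linarith
  have htgt : 0 ≤ eval (targetII3 c P) u v t := hT ▸ hT0
  rw [targetII3, eval_neg, eval_append, eval_C, eval_smul, hP.hF u v t hu1 hv1 ht1] at htgt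
  push_cast at htgt
  generalize hF : Fval3 c.F u v t = FV at htgt ⊢
  -- htgt : 0 ≤ -(6 q 4^Sp 4^Spp B22 + q 2^S 4^Spp FV)
  have key : (c.q : ℝ) * 4 ^ c.Spp * (6 * 4 ^ c.Sp * (c.B22 : ℝ) + 2 ^ c.S * FV) ≤ 0 := by nlinarith [htgt]
  have hpos1 : (0 : ℝ) < (c.q : ℝ) * 4 ^ c.Spp := by positivity
  have key2 : 6 * 4 ^ c.Sp * (c.B22 : ℝ) + 2 ^ c.S * FV ≤ 0 := by
    by_contra hcon
    have hcon' := lt_of_not_ge hcon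
    have := mul_pos hpos1 hcon'
    linarith
  have h2S : (0 : ℝ) < 2 ^ c.S := by positivity
  have h4S : (0 : ℝ) < 6 * 4 ^ c.Sp := by positivity
  have e : FV / (6 * 4 ^ c.Sp) + (c.B22 : ℝ) / 2 ^ c.S =
      (6 * 4 ^ c.Sp * (c.B22 : ℝ) + 2 ^ c.S * FV) / (6 * 4 ^ c.Sp * 2 ^ c.S) := by
    field_simp
    ring
  have hle : FV / (6 * 4 ^ c.Sp) + (c.B22 : ℝ) / 2 ^ c.S ≤ 0 := by
    rw [e]; exact div_nonpos_of_nonpos_of_nonneg key2 (by positivity)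
  linarith

set_option maxHeartbeats 4000000 in
/-- Soundness of `(I')` on `S²`: `A(s') + 3F(s',s',1) ≤ -1 - 2b₁₂ - b₂₂` for `s' ∈ [-1, p/q]`, where
`A = Ã/2^{S+d}`, `F = F_int/(6·4^Sp)`. [folklore] -/
theorem AF_of_check3 (c : Cert3) (P : CertPolys)
    (hP : PolysOK3 c P) (h : checkI3 c P = true) (hs : checkSide3 c = true) (s : ℝ)
    (hs1 : -1 ≤ s) (hs2 : s ≤ (c.p : ℝ) / c.q) (hp1 : (c.p : ℝ) / c.q ≤ 1) :
    Aval3 c.d c.A s / 2 ^ (c.S + c.d) + 3 * (Fval3 c.F s s 1 / (6 * 4 ^ c.Sp)) ≤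
      -1 - 2 * (c.B12 / 2 ^ c.S) - c.B22 / 2 ^ c.S := by
  simp only [checkSide3, Bool.and_eq_true, decide_eq_true_eq] at hs
  obtain ⟨⟨⟨⟨⟨⟨⟨⟨hq0, _⟩, _⟩, _⟩, _⟩, _⟩, _⟩, _⟩, _⟩ := hs
  have hqR : (0 : ℝ) < c.q := by exact_mod_cast hq0
  have hu1 : |s| ≤ 1 := abs_le.2 ⟨hs1, by linarith⟩
  have h01 : |(0 : ℝ)| ≤ 1 := by norm_num
  have hres := abs_eval_le_of_residualBound _ _ h hu1 h01 h01
  rw [eval_mergeAll] at hres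
  simp only [List.map_cons, List.map_nil, List.sum_cons, List.sum_nil, add_zero, eval_neg, eval_C,
    Int.cast_natCast] at hres
  have mulx : 0 ≤ ((c.p : ℝ) - c.q * s) * (1 + s) := by
    have : (c.q : ℝ) * s ≤ c.p := by
      have := mul_le_mul_of_nonneg_left hs2 hqR.le
      rwa [mul_div_cancel₀ _ hqR.ne'] at this
    exact mul_nonneg (by linarith) (by linarith)
  have hrhs : 0 ≤ eval (rhsI3 c P) s 0 0 := by
    have h0 := hP.hq s 0 0 hu1 h01 h01
    have h1 := hP.hq1 s 0 0 hu1 h01 h01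
    rw [rhsI3, eval_mergeAll]
    simp only [List.map_cons, List.map_nil, List.sum_cons, List.sum_nil, add_zero, eval_mulN, eval_smul,
      eval_ptX3, eval_U]
    push_cast
    generalize eval P.Qq s 0 0 = q0 at *
    generalize eval P.Qq1 s 0 0 = q1' at *
    have c1 : (0 : ℝ) ≤ 6 * c.q * 2 ^ (c.S + c.d) * 4 ^ c.Sp := by positivity
    have c2 : (0 : ℝ) ≤ 6 * 2 ^ (c.S + c.d) * 4 ^ c.Sp := by positivity
    nlinarith [mul_nonneg c1 h0, mul_nonneg c2 (mul_nonneg mulx h1)]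
  generalize hR : eval (rhsI3 c P) s 0 0 = R at hres hrhs
  generalize hT : eval (targetI3 c P) s 0 0 = T at hres
  have hT0 : 0 ≤ T := by
    have h1 := (abs_le.1 hres).1
    linarith
  have htgt : 0 ≤ eval (targetI3 c P) s 0 0 := hT ▸ hT0
  have h11 : |(1 : ℝ)| ≤ 1 := by norm_num
  have hFss : eval (substUU1 P.FP) s 0 0 = Fval3 c.F s s 1 := by
    rw [eval_substUU1, hP.hF s s 1 hu1 hu1 h11]
  rw [targetI3, eval_neg, eval_append, eval_append, eval_append, eval_C, eval_smul, eval_APoly3,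
    eval_C, eval_smul, hFss] at htgt
  push_cast at htgt
  generalize hF : Fval3 c.F s s 1 = FV at htgt ⊢
  generalize hA : Aval3 c.d c.A s = AV at htgt ⊢
  -- htgt : 0 ≤ -(D_I + 6q4^Sp4^Spp·AV + 6q2^d4^Sp4^Spp(2B12+B22) + 3q2^{S+d}4^Spp·FV)
  have key : (c.q : ℝ) * 4 ^ c.Spp *
      (6 * 2 ^ (c.S + c.d) * 4 ^ c.Sp + 6 * 4 ^ c.Sp * AV + 6 * 2 ^ c.d * 4 ^ c.Sp * (2 * (c.B12 : ℝ) + c.B22)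
        + 3 * 2 ^ (c.S + c.d) * FV) ≤ 0 := by nlinarith [htgt]
  have hpos1 : (0 : ℝ) < (c.q : ℝ) * 4 ^ c.Spp := by positivity
  have key2 : 6 * 2 ^ (c.S + c.d) * 4 ^ c.Sp + 6 * 4 ^ c.Sp * AV + 6 * 2 ^ c.d * 4 ^ c.Sp * (2 * (c.B12 : ℝ) + c.B22)
        + 3 * 2 ^ (c.S + c.d) * FV ≤ 0 := by
    by_contra hcon
    have hcon' := lt_of_not_ge hcon
    have := mul_pos hpos1 hcon'
    linarith
  have h2S : (0 : ℝ) < 2 ^ c.S := by positivity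
  have h2d : (0 : ℝ) < 2 ^ c.d := by positivity
  have h2Sd : (2 : ℝ) ^ (c.S + c.d) = 2 ^ c.S * 2 ^ c.d := pow_add _ _ _
  have h4S : (0 : ℝ) < 4 ^ c.Sp := by positivity
  -- divide key2 by 6·2^{S+d}·4^Sp
  have e : AV / 2 ^ (c.S + c.d) + 3 * (FV / (6 * 4 ^ c.Sp)) - (-1 - 2 * (c.B12 / 2 ^ c.S) - c.B22 / 2 ^ c.S)
      = (6 * 2 ^ (c.S + c.d) * 4 ^ c.Sp + 6 * 4 ^ c.Sp * AV + 6 * 2 ^ c.d * 4 ^ c.Sp * (2 * (c.B12 : ℝ) + c.B22)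
        + 3 * 2 ^ (c.S + c.d) * FV) / (6 * 2 ^ (c.S + c.d) * 4 ^ c.Sp) := by
    rw [h2Sd]
    field_simp
    ring
  have hden : (0 : ℝ) < 6 * 2 ^ (c.S + c.d) * 4 ^ c.Sp := by positivity
  have : AV / 2 ^ (c.S + c.d) + 3 * (FV / (6 * 4 ^ c.Sp)) - (-1 - 2 * (c.B12 / 2 ^ c.S) - c.B22 / 2 ^ c.S) ≤ 0 := by
    rw [e]; exact div_nonpos_of_nonpos_of_nonneg key2 hden.le
  linarith

/-- The `b`-matrix of an `S²` certificate is positive semidefinite as a quadratic. [folklore] -/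
theorem bquad_nonneg_of_check3 (c : Cert3) (hs : checkSide3 c = true) (l : ℝ) :
    0 ≤ c.B11 / 2 ^ c.S + 2 * (c.B12 / 2 ^ c.S) * l + c.B22 / 2 ^ c.S * l ^ 2 := by
  simp only [checkSide3, Bool.and_eq_true, decide_eq_true_eq] at hs
  obtain ⟨⟨⟨_, h11⟩, h22⟩, hdet⟩ := hs
  have h11' : (0 : ℝ) ≤ c.B11 := by exact_mod_cast h11
  have h22' : (0 : ℝ) < c.B22 := by exact_mod_cast h22
  have hdet' : (c.B12 : ℝ) * c.B12 ≤ c.B11 * c.B22 := by exact_mod_cast hdet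
  have h2S : (0 : ℝ) < 2 ^ c.S := pow_pos (by norm_num) _
  have hq : 0 ≤ (c.B11 : ℝ) + 2 * c.B12 * l + c.B22 * l ^ 2 := by
    have hmul : 0 ≤ (c.B22 : ℝ) * (c.B11 + 2 * c.B12 * l + c.B22 * l ^ 2) := by
      nlinarith [sq_nonneg ((c.B22 : ℝ) * l + c.B12)]
    exact nonneg_of_mul_nonneg_right (by linarith [hmul]) h22'
  have : (c.B11 : ℝ) / 2 ^ c.S + 2 * (c.B12 / 2 ^ c.S) * l + c.B22 / 2 ^ c.S * l ^ 2 =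
      (c.B11 + 2 * c.B12 * l + c.B22 * l ^ 2) / 2 ^ c.S := by
    field_simp
  rw [this]
  exact div_nonneg hq h2S.le

/-- **The bound from a checked `S²` certificate** (Bachoc–Vallentin Thm 4.2 on `S²`, instantiated):
`|C| ≤ 1 + A(1) + b₁₁ + F(1,1,1)` for every finite set of unit vectors of `ℝ³` with pairwise inner
products `≤ p/q` (`p/q ≤ 1`). [cite: BachocVallentin2007, Theorem 4.2] -/
theorem card_le_of_cert3 (c : Cert3) (P : CertPolys)
    (hP : PolysOK3 c P) (hI : checkI3 c P = true) (hII : checkII3 c P = true)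
    (hs : checkSide3 c = true) (hp1 : (c.p : ℝ) / c.q ≤ 1)
    (hpos : 0 ≤ 1 + Aval3 c.d c.A 1 / 2 ^ (c.S + c.d) + c.B11 / 2 ^ c.S + Fval3 c.F 1 1 1 / (6 * 4 ^ c.Sp))
    (C : Finset (EuclideanSpace ℝ (Fin 3))) (hC : ∀ x ∈ C, ‖x‖ = 1)
    (hcode : ∀ x ∈ C, ∀ y ∈ C, x ≠ y → inner ℝ x y ≤ (c.p : ℝ) / c.q) :
    (C.card : ℝ) ≤ 1 + Aval3 c.d c.A 1 / 2 ^ (c.S + c.d) + c.B11 / 2 ^ c.S + Fval3 c.F 1 1 1 / (6 * 4 ^ c.Sp) := by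
  have hs' := hs
  simp only [checkSide3, Bool.and_eq_true, decide_eq_true_eq, List.all_eq_true] at hs'
  obtain ⟨⟨⟨⟨⟨⟨⟨⟨hq0, _⟩, _⟩, _⟩, _⟩, hApos⟩, h11⟩, h22⟩, hdet⟩ := hs'
  have h2S : (0 : ℝ) < 2 ^ (c.S + c.d) := by positivity
  have h4S : (0 : ℝ) < 6 * 4 ^ c.Sp := by positivity
  have hApos' : ∀ k, 0 ≤ c.A.getD k 0 := by
    intro k
    simp only [List.getD_eq_getElem?_getD]
    cases h : c.A[k]? with
    | none => simp
    | some a => simpa using hApos a (List.mem_iff_getElem?.2 ⟨k, h⟩)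
  have hA : 0 ≤ BachocVallentin.pairSum C (fun u => Aval3 c.d c.A u / 2 ^ (c.S + c.d)) := by
    have h0 := pairSum_Aval3_nonneg c.d c.A hApos' C hC
    unfold BachocVallentin.pairSum at h0 ⊢
    have e : (∑ x ∈ C, ∑ y ∈ C, Aval3 c.d c.A (inner ℝ x y) / 2 ^ (c.S + c.d)) =
        (∑ x ∈ C, ∑ y ∈ C, Aval3 c.d c.A (inner ℝ x y)) / 2 ^ (c.S + c.d) := by
      rw [Finset.sum_div]; refine Finset.sum_congr rfl fun x _ => ?_; rw [Finset.sum_div]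
    rw [e]; exact div_nonneg h0 h2S.le
  have hF : 0 ≤ BachocVallentin.tripleSum C (fun u v t => Fval3 c.F u v t / (6 * 4 ^ c.Sp)) := by
    have h0 := tripleSum_Fval3_nonneg c.F C hC
    unfold BachocVallentin.tripleSum at *
    have : (∑ x ∈ C, ∑ y ∈ C, ∑ z ∈ C, Fval3 c.F (inner ℝ x y) (inner ℝ x z) (inner ℝ y z) / (6 * 4 ^ c.Sp))
        = (∑ x ∈ C, ∑ y ∈ C, ∑ z ∈ C, Fval3 c.F (inner ℝ x y) (inner ℝ x z) (inner ℝ y z)) / (6 * 4 ^ c.Sp) := by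
      rw [Finset.sum_div]; refine Finset.sum_congr rfl fun x _ => ?_
      rw [Finset.sum_div]; refine Finset.sum_congr rfl fun y _ => ?_
      rw [Finset.sum_div]
    rw [this]
    exact div_nonneg h0 h4S.le
  refine BachocVallentin.card_le_of_threePoint ((c.p : ℝ) / (c.q : ℝ)) C hC hcode
    (fun u : ℝ => (Aval3 c.d c.A u / 2 ^ (c.S + c.d) : ℝ))
    (fun u v t : ℝ => (Fval3 c.F u v t / (6 * 4 ^ c.Sp) : ℝ)) ((c.B11 : ℝ) / 2 ^ c.S) ((c.B12 : ℝ) / 2 ^ c.S)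
    ((c.B22 : ℝ) / 2 ^ c.S) hA hF ?_ ?_ (bquad_nonneg_of_check3 c hs) ?_ ?_ hpos
  · intro u v t; rw [Fval3_swap12]
  · intro u v t; rw [Fval3_swap23]
  · intro s hs1 hs2; exact AF_of_check3 c P hP hI hs s hs1 hs2 hp1
  · intro u v t hu hu' hv hv' ht ht' hp
    exact FII_of_check3 c P hP hII hs u v t hu hu' hv hv' ht ht' hp1 hp

/-! ### The numerical value of the bound -/

/-- The bound is `< 13` and `≥ 0` when `checkBound3` succeeds. [folklore] -/
theorem bound_of_check3 (c : Cert3) (P : CertPolys) (hF : FexpValid3 c.F P.FP)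
    (h : checkBound3 c P = true) :
    1 + Aval3 c.d c.A 1 / 2 ^ (c.S + c.d) + c.B11 / 2 ^ c.S + Fval3 c.F 1 1 1 / (6 * 4 ^ c.Sp) < 13 ∧
      0 ≤ 1 + Aval3 c.d c.A 1 / 2 ^ (c.S + c.d) + c.B11 / 2 ^ c.S + Fval3 c.F 1 1 1 / (6 * 4 ^ c.Sp) := by
  simp only [checkBound3, Bool.and_eq_true, decide_eq_true_eq] at h
  obtain ⟨hlt, hge⟩ := h
  have h11 : |(1 : ℝ)| ≤ 1 := by norm_num
  have hAv : Aval3 c.d c.A 1 = (coeffSum (APoly3 c.d c.A) : ℝ) := by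
    rw [← eval_APoly3 c.d c.A 1 1 1, eval_one_one_one]
  have hFv : Fval3 c.F 1 1 1 = (coeffSum P.FP : ℝ) := by
    rw [← hF 1 1 1 h11 h11 h11, eval_one_one_one]
  rw [hAv, hFv]
  generalize (coeffSum (APoly3 c.d c.A)) = IA at *
  generalize (coeffSum P.FP) = IF at *
  have h2S : (0 : ℝ) < 2 ^ c.S := by positivity
  have h2d : (0 : ℝ) < 2 ^ c.d := by positivity
  have h2Sd : (2 : ℝ) ^ (c.S + c.d) = 2 ^ c.S * 2 ^ c.d := pow_add _ _ _
  have h4S : (0 : ℝ) < 4 ^ c.Sp := by positivity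
  have hlt' : ((6 : ℝ) * 2 ^ (c.S + c.d) * 4 ^ c.Sp + 6 * 4 ^ c.Sp * IA + 6 * 2 ^ c.d * 4 ^ c.Sp * c.B11
      + 2 ^ (c.S + c.d) * IF) < 13 * 6 * 2 ^ (c.S + c.d) * 4 ^ c.Sp := by exact_mod_cast hlt
  have hge' : (0 : ℝ) ≤ (6 : ℝ) * 2 ^ (c.S + c.d) * 4 ^ c.Sp + 6 * 4 ^ c.Sp * IA + 6 * 2 ^ c.d * 4 ^ c.Sp * c.B11
      + 2 ^ (c.S + c.d) * IF := by exact_mod_cast hge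
  have e : (1 : ℝ) + IA / 2 ^ (c.S + c.d) + c.B11 / 2 ^ c.S + IF / (6 * 4 ^ c.Sp) =
      ((6 : ℝ) * 2 ^ (c.S + c.d) * 4 ^ c.Sp + 6 * 4 ^ c.Sp * IA + 6 * 2 ^ c.d * 4 ^ c.Sp * c.B11
        + 2 ^ (c.S + c.d) * IF) / (6 * 2 ^ (c.S + c.d) * 4 ^ c.Sp) := by
    rw [h2Sd]
    field_simp
  rw [e]
  have hden : (0 : ℝ) < 6 * 2 ^ (c.S + c.d) * 4 ^ c.Sp := by positivity
  constructor
  · rw [div_lt_iff₀ hden]; linarith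
  · exact div_nonneg hge' hden.le

/-- **From a fully checked `S²` certificate to `|C| ≤ 12`**: if the side conditions, the expansions,
the two polynomial checks and the numerical bound all pass, every finite set of unit vectors of `ℝ³`
with pairwise inner products `≤ p/q` (with `p/q ≤ 1`) has at most `12` elements — i.e. there are no 13
points of `S²` with pairwise angular distances `≥ arccos(p/q)`. [cite: BachocVallentin2007, Theorem 4.2] -/
theorem card_le_12_of_cert3 (c : Cert3) (P : CertPolys)
    (hP : PolysOK3 c P) (hI : checkI3 c P = true) (hII : checkII3 c P = true)
    (hs : checkSide3 c = true) (hb : checkBound3 c P = true) (hp1 : (c.p : ℝ) / c.q ≤ 1)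
    (C : Finset (EuclideanSpace ℝ (Fin 3))) (hC : ∀ x ∈ C, ‖x‖ = 1)
    (hcode : ∀ x ∈ C, ∀ y ∈ C, x ≠ y → inner ℝ x y ≤ (c.p : ℝ) / c.q) : C.card ≤ 12 := by
  have hbd := bound_of_check3 c P hP.hF hb
  have h := card_le_of_cert3 c P hP hI hII hs hp1 hbd.2 C hC hcode
  have hlt : (C.card : ℝ) < 13 := lt_of_le_of_lt h hbd.1
  have hlt' : C.card < 13 := by exact_mod_cast hlt
  omega

end PolyCert.SPoly

end Summit.Ventures.Crystal3D.TopCut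

end
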